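import Summits.CriticalPhenomena.Ising3D.ExclusionSentencesLin

/-!
# Exclusion sentences — 2D control, third datum `c = 1/2` vs family `LIN` at `10⁻⁷`
(cell `pub-ising3x`, seat recog-1, gen 6)

HONEST FRAMING: lottery ticket; floor = tightest certified 3D Ising CFT bounds; no exact-solution
claim without a proof.

The whole FAMILIES-v1 family `LIN` (`(a₀ + Σ cᵢKᵢ)/aₓ`, `K = (π, π², π³, log 2, ζ(3), ζ(5), G)`, `≤ 2` of the
`cᵢ` non-zero, height `≤ 12`) near the 2D control's third datum `c = 1/2`: at the blind width `10⁻⁵` the table has 26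
members and at `10⁻⁶` still 8 (Python twin `tools/trglin_exceptions.py`; exclusion data, not listed here), at `10⁻⁷`
NONE — the exception list is EMPTY.  Four `linExcludedPart` evaluations (one `decide +kernel` each, ≈ 20 s) assembled
by `linExcluded_of_parts`, and the printed shape `control_c7_not_lin`.  Used by `ExclusionSentencesControl2DRecognisedC.lean`.
No 3D digit is used anywhere.
-/

namespace Summit.CriticalPhenomena.Ising3D

/-- Part 0 of the `H = 12` LIN sentence on `[1/2 − 10⁻⁷, 1/2 + 10⁻⁷]`, empty exception list. -/
theorem linExcluded_control_c7_p0 :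
    linExcludedPart 12 0 (1 / 2 - 1 / 10 ^ 7) (1 / 2 + 1 / 10 ^ 7) [] = true := by
  decide +kernel

/-- Part 1. -/
theorem linExcluded_control_c7_p1 :
    linExcludedPart 12 1 (1 / 2 - 1 / 10 ^ 7) (1 / 2 + 1 / 10 ^ 7) [] = true := by
  decide +kernel

/-- Part 2. -/
theorem linExcluded_control_c7_p2 :
    linExcludedPart 12 2 (1 / 2 - 1 / 10 ^ 7) (1 / 2 + 1 / 10 ^ 7) [] = true := by
  decide +kernel

/-- Part 3. -/
theorem linExcluded_control_c7_p3 :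
    linExcludedPart 12 3 (1 / 2 - 1 / 10 ^ 7) (1 / 2 + 1 / 10 ^ 7) [] = true := by
  decide +kernel

/-- **LIN sentence at the 2D control `c = 1/2`, width `10⁻⁷`**: the whole `H = 12` table has NO member in
`[1/2 − 10⁻⁷, 1/2 + 10⁻⁷]`. -/
theorem linExcluded_control_c7 :
    linExcluded 12 (1 / 2 - 1 / 10 ^ 7) (1 / 2 + 1 / 10 ^ 7) [] = true :=
  linExcluded_of_parts linExcluded_control_c7_p0 linExcluded_control_c7_p1 linExcluded_control_c7_p2
    linExcluded_control_c7_p3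

/-- Printed shape: a real within `10⁻⁷` of `1/2` is no LIN form of height `≤ 12`. -/
theorem control_c7_not_lin {x : ℝ}
    (hx : ((1 / 2 - 1 / 10 ^ 7 : ℚ) : ℝ) ≤ x ∧ x ≤ ((1 / 2 + 1 / 10 ^ 7 : ℚ) : ℝ)) : x ∉ linFamily 12 := by
  intro hm
  obtain ⟨e, he, _⟩ := linExcluded_sound linExcluded_control_c7 hx hm
  simp at he

end Summit.CriticalPhenomena.Ising3D
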